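import Summits.CriticalPhenomena.PercolationContinuityZ3.Theorems.PercNearOneGluingNoHeavyLowerTailSahiCombTriWCorNonneg
import Summits.CriticalPhenomena.PercolationContinuityZ3.Theorems.PercNearOneGluingNoHeavyLowerTailSahiCombTriWSaturated

/-!
# OUTER-LAYER KLEITMAN: the typed conjecture behind `TriWIneq` for every symmetric THRESHOLD test set, and the reduction

Support file of the one-cut programme (crux `NoHeavyLowerTail`, stmt-CriticalPhenomena-4575; cell `prim-masterthm`, seat P5 gen 24; memo
`FROM-prim-masterthm-p5-g24-SANDWICH.md` §7(c)–(l)).  For `2k > n = #γ` the threshold family `P_k = {w | k ≤ #w}` ("at least k of n") is an INTERSECTING up-set, and the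
constant sandwich certificate of `…TriWCorNonneg` applies as soon as its antipodal correlation is non-negative:

  `(OLK)  Cor_{P_k}(A,B) = #(T∩A∩B) − #(T∩A∩refl B) ≥ 0`  for all up-sets `A, B`,  `T = P_k ∪ refl P_k = {w | #w ≤ n−k ∨ k ≤ #w}` (the OUTER LAYERS),

i.e. Kleitman's antipodal inequality restricted to the outer layers of the cube (`FiveUpSet.ThresholdCorNonneg`, CONJECTURE).  EVIDENCE (P5 gen 24, exact): every pair of up-sets of
`2^n`, `n ≤ 5`, every `k` (minimum exactly `0`, kit j171714); all `2645²` pairs of intersecting up-sets of `2^5` (j172415); alternating exact minimisation from 400/150/40 random starts at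
`n = 6, 7, 8` and 20 000 / 4 000 random intersecting pairs at `n = 6 / 7`: no negative value; exhaustive `n = 6`: kit j172192.  PROVED CASES in the tree: `k = n` (`P = {univ}`, principal),
`n` odd and `k = (n+1)/2` (majority, self-dual: `…TriWCorNonneg`/`…TriWSelfDual`), `k = n − 1` (`…TriWCoatoms`, gen 24).  Equivalent forms (memo §7): for every (WLOG shifted — a proved
reduction) intersecting up-set `U`, the family `U ∩ T` has a permutation `π` with `u ∪ π u = univ`; a WARNING: the analogue for a non-symmetric outer region is false.
This file: the typed statement, **`FiveUpSet.triW_nonneg_threshold_of_corNonneg : ThresholdCorNonneg → TriWIneq for every P_k with 2k > n`** (all index cubes, all `a`), and the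
unconditional LOW-threshold half **`triW_nonneg_threshold_low`** (`2k ≤ n + 1`: then `P_k` is saturated and prim-lf-1's `triW_nonneg_of_saturated` applies) — so the symmetric thresholds
are settled exactly up to (OLK) for `2k ≥ n + 2`.
HONEST LABEL: `ThresholdCorNonneg` is a CONJECTURE (an obligation of our theory, never a fact); the reduction is proved (std axioms). [this work]
-/

namespace Summit.CriticalPhenomena.PercolationContinuityZ3.Theorems

namespace FiveUpSet

open Finset

variable {β γ : Type} [DecidableEq β] [Fintype β] [DecidableEq γ] [Fintype γ]

/-- The symmetric THRESHOLD family "at least `k` of `n`": `{w | k ≤ #w}`. [this work] -/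
def thresholdFamily (γ : Type) [DecidableEq γ] [Fintype γ] (k : ℕ) : Finset (Finset γ) := univ.filter fun w => k ≤ w.card

omit [DecidableEq β] [Fintype β] in
/-- Membership in the threshold family. [this work] -/
@[simp] theorem mem_thresholdFamily {k : ℕ} {w : Finset γ} : w ∈ thresholdFamily γ k ↔ k ≤ w.card := by
  simp [thresholdFamily]

omit [DecidableEq β] [Fintype β] in
/-- The threshold family is an up-set. [this work] -/
theorem isUpperSet_thresholdFamily (k : ℕ) : IsUpperSet (thresholdFamily γ k : Set (Finset γ)) := by
  intro w w' hww' hw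
  rw [mem_coe, mem_thresholdFamily] at hw ⊢
  exact hw.trans (card_le_card hww')

/-- **Outer-layer Kleitman** (CONJECTURE — an obligation of our theory, never a fact; memo §7(c)).  For every finite `γ` and every `k` with `#γ < 2k`, the threshold family
`P_k = {w | k ≤ #w}` is antipodally positively correlated: `0 ≤ Cor_{P_k}(A,B)` for all up-sets `A, B` of `Finset γ` — equivalently `#(T∩A∩B) ≥ #(T∩A∩refl B)` on the outer layers
`T = {#w ≤ #γ−k} ∪ {k ≤ #w}`.  Exhaustively verified for `#γ ≤ 5` (all pairs of up-sets, all `k`); no counterexample in large searches at `#γ ≤ 8`; proved for `k ∈ {#γ, #γ−1}` and for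
the self-dual case `2k = #γ+1`. [this work] -/
@[conjecture] def ThresholdCorNonneg : Prop :=
  ∀ (γ : Type) [DecidableEq γ] [Fintype γ] (k : ℕ), Fintype.card γ < 2 * k →
    ∀ A B : Finset (Finset γ), IsUpperSet (A : Set (Finset γ)) → IsUpperSet (B : Set (Finset γ)) → 0 ≤ corP (thresholdFamily γ k) A B

/-- **`ThresholdCorNonneg ⟹ TriWIneq` for every symmetric threshold test set** `P_k`, `2k > n`: `0 ≤ triW (thresholdFamily γ k) F G` for every index cube and all monotone families of
up-sets (the constant sandwich certificate `triW_nonneg_of_corP_nonneg`).  (For `2k ≤ n+1` the family is SATURATED — every set or its complement has `≥ k` elements — and prim-lf-1's `triW_nonneg_of_saturated` applies unconditionally: `triW_nonneg_threshold_low`.) [this work] -/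
theorem triW_nonneg_threshold_of_corNonneg (h : ThresholdCorNonneg) (k : ℕ) (hk : Fintype.card γ < 2 * k)
    (F G : Finset β → Finset (Finset γ))
    (hF : ∀ x, IsUpperSet (F x : Set (Finset γ))) (hG : ∀ x, IsUpperSet (G x : Set (Finset γ)))
    (hFm : Monotone F) (hGm : Monotone G) :
    0 ≤ triW (thresholdFamily γ k) F G :=
  triW_nonneg_of_corP_nonneg (isUpperSet_thresholdFamily k) (fun A B hA hB => h γ k hk A B hA hB) F G hF hG hFm hGm

omit [DecidableEq β] [Fintype β] in
/-- LOW thresholds are saturated: if `k + k ≤ #γ + 1` then every set or its complement has at least `k` elements. [this work] -/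
theorem thresholdFamily_saturated {k : ℕ} (hk : k + k ≤ Fintype.card γ + 1) (e : Finset γ) :
    e ∈ thresholdFamily γ k ∨ eᶜ ∈ thresholdFamily γ k := by
  rw [mem_thresholdFamily, mem_thresholdFamily, card_compl]
  by_contra h
  rw [not_or, not_le, not_le] at h
  have h1 := h.1
  have h2 := h.2
  have hle : e.card ≤ Fintype.card γ := card_le_univ e
  omega

/-- **`TriWIneq` for the LOW symmetric thresholds, unconditionally**: if `k + k ≤ #γ + 1` then `0 ≤ triW (thresholdFamily γ k) F G` for every index cube and all monotone families of
up-sets (prim-lf-1's saturated stratum `triW_nonneg_of_saturated`). [this work] -/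
theorem triW_nonneg_threshold_low {k : ℕ} (hk : k + k ≤ Fintype.card γ + 1) (F G : Finset β → Finset (Finset γ))
    (hF : ∀ x, IsUpperSet (F x : Set (Finset γ))) (hG : ∀ x, IsUpperSet (G x : Set (Finset γ)))
    (hFm : Monotone F) (hGm : Monotone G) :
    0 ≤ triW (thresholdFamily γ k) F G :=
  triW_nonneg_of_saturated (isUpperSet_thresholdFamily k) (thresholdFamily_saturated hk) F G hF hG hFm hGm

end FiveUpSet

end Summit.CriticalPhenomena.PercolationContinuityZ3.Theorems
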